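import Summits.KontsevichZagierPeriods.KontsevichZagierPeriods.Theorems.RootDecompWalshStrataBall4Rung
import Summits.KontsevichZagierPeriods.KontsevichZagierPeriods.Theorems.RootDecompWalshStrataSplit4Descent

/-!
# `QuadricFour` rung: the split cell `x₀x₁ + x₂x₃ > 1` is a third instance of `QuadricTwoDescentFour`

Route `RootDecompWalshStrata` (cell decomp-kz, lens 4, gen 11).  Plugs the proved split descent
(`Split4.split4_twoDescent`, parts `RootDecompWalshStrataSplit4{Band,Chart,Descent}`) into the typed node
of `RootDecompWalshStrataQuadricFourRung` / `…Ball4Rung`: `quadricTwoDescentFourAt_split4 :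
QuadricTwoDescentFourAt split4Poly` — after the 4-ball (definite, weight 2) and the paraboloid (rank 3 +
linear, weight 1), the INDEFINITE type of signature `(2,2)` (value `q(π²/12 − 3/4)`, a `ζ(2)`-bearing
rational 2-cell) is decided inside the rules, with polynomial data only.  0 sorry.
[KontsevichZagier2001 §1.2]
-/

namespace Summit.KontsevichZagierPeriods.RootDecompWalshStrata.QuadricFourRung

open Literature.NumberTheory.Transcendental
open Summit.KontsevichZagierPeriods.RootDecompWalshStrata.Split4 (split4Poly split4_twoDescent)

/-- `deg (x₀x₁ + x₂x₃ − 1) ≤ 2`. [folklore] -/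
theorem totalDegree_split4Poly_le : split4Poly.totalDegree ≤ 2 := by
  unfold split4Poly
  refine (MvPolynomial.totalDegree_sub _ _).trans (max_le ?_ (by simp))
  refine (MvPolynomial.totalDegree_add _ _).trans (max_le ?_ ?_)
  · exact (MvPolynomial.totalDegree_mul _ _).trans (by simp [MvPolynomial.totalDegree_X])
  · exact (MvPolynomial.totalDegree_mul _ _).trans (by simp [MvPolynomial.totalDegree_X])

/-- **Third specimen of generation 11:** the slice of `QuadricTwoDescentFour` at the split quadric cell
`x₀x₁ + x₂x₃ > 1` holds — decided inside the three KZ rules (`Split4.split4_twoDescent`).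
[KontsevichZagier2001 §1.2; this node] -/
theorem quadricTwoDescentFourAt_split4 : QuadricTwoDescentFourAt split4Poly :=
  fun q ρ hρ _ => split4_twoDescent q ρ hρ

end Summit.KontsevichZagierPeriods.RootDecompWalshStrata.QuadricFourRung
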